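import Literature.AlgebraicGeometry.Motives.HodgeLieTimesCMCurve
import Literature.AlgebraicGeometry.Motives.HodgeLieSemisimpleTimesAbelian
import HarnessLib

/-!
# `𝔥(H₁ ⊕ H₂) = 𝔥(H₁) × 𝔥(H₂)` for a summand `H₂` with ABELIAN `𝔥(H₂)` (any rank) and `H₁` with skew centre `ℚφ₁`, unless the Hodge
# operator of `H₂` resonates: `tr(φ₁²)·Θ₂ − tr(Θ₁φ₁)·y₀ ∈ K ⊗ ℂ` for a PROPER rational subspace `K ⊊ 𝔥(H₂)`
# (Moonen–Zarhin 1999 Lemma (3.6) «if `Hg(X₁ × X₂) ≠ Hg(X₁) × Hg(X₂)` then the centre of `Hg(X₁)` contains a torus isogenous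
# to `Hg(X₂)`», for the Lie algebra `hodgeLie` itself and an arbitrary CM summand)

Family `hodge`, layer `Literature/AlgebraicGeometry/Motives`; THEOREMS ONLY (no definition, no named fact).  Written for the cell
`pub-hodgecm2` (COR-CM), seat `b27` gen 49 (count-neutral Mumford–Tate-rank ladder: the cell CM SURFACE × type IV).  Sequel of
`Motives/HodgeLieTimesCMCurve` (gen 48), which is the case `dim_ℚ V₂ = 2`, `𝔥(H₂) ⊆ ℚφ₂`; here `𝔥(H₂)` is any ABELIAN Lie algebra
(for the `H¹` of an abelian variety: `X₂` of CM type), and the conclusion is phrased so that the arithmetic of `H₂` is used only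
through ONE property («twisted `Θ`-rigidity», supplied for simple CM surfaces by `Motives/HodgeLieRankFourTwistedRigidity`).

SETTING.  `H ≅ H₁ ⊕ H₂` (morphisms `ι_i`, `π_i` with `π_i ι_i = id`, `ι₁ π₁ + ι₂ π₂ = id`) of weight `n`, polarizations `ψ` of `H` and
`ψ₁` of `H₁`; a Hodge endomorphism `φ₁` of `H₁` such that (Z₁) every `ψ₁`-skew CENTRAL Hodge endomorphism of `H₁` lies in `ℚφ₁`
(e.g. `H₁ = H¹(T)`, `End⁰T` an imaginary quadratic field); (AB₂) `𝔥(H₂)` abelian.  Write `r_i X = π_i X ι_i` for the blocks,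
`𝔷(H) = 𝔥(H) ∩ End_Hdg(H)`, `𝔷₀(H) = {z ∈ 𝔷(H) : r₁ z = 0}`, `K = r₂ 𝔷₀(H) ⊆ 𝔥(H₂)`.
1. §2: brackets of `𝔥(H)` have zero `V₂`-block (`r₂` is multiplicative on `𝔥(H)` and `𝔥(H₂)` is abelian; the tree's
   `comp_eq_zero_of_mem_derived_of_abelian`) and `φ₁`-trace-free `V₁`-block (`trace_restrict₁_commutator_mul_eq_zero`).
2. §3: a central `z` has `r₁ z = x φ₁`, `x ∈ ℚ` (Z₁); an element of `𝔷₀(H)` IS the corner `ι₂ (r₂ z) π₂` of an element of `𝔥(H₂)`;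
   EITHER `𝔷(H) = 𝔷₀(H)`, OR `𝔷(H) = ℚ z₀ ⊕ 𝔷₀(H)` with `r₁ z₀ = x₀ φ₁`, `x₀ ≠ 0` (`center_le_span_sup_of_abelian`).
3. §4 (Deligne `𝔥 = 𝔷 ⊕ 𝔡`, `AnyWeight.hodgeLie_center_sup_derived_eq`, and `Θ_H ∈ 𝔥(H)_ℂ`): `Θ_H = λ z₀,ℂ + k + s`, `k ∈ 𝔷₀(H)_ℂ`,
   `s ∈ 𝔡(H)_ℂ`; the trace functional `Z ↦ tr((r₁ Z) φ₁,ℂ)` gives `tr(Θ₁ φ₁,ℂ) = λ x₀ tr(φ₁²)`, the block map `r₂` gives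
   `Θ₂ = λ (r₂ z₀)_ℂ + r₂ k` with `r₂ k ∈ K_ℂ`; eliminating `λ`: **`tr(φ₁²)·Θ₂ − tr(Θ₁φ₁,ℂ)·(y₀)_ℂ ∈ K_ℂ`**, `y₀ = x₀⁻¹ r₂ z₀ ∈ 𝔥(H₂)`
   (`exists_trace_eq_and_theta_sub_smul_mem_spanC`).
4. §5 THE DICHOTOMY (`forall_corner_mem_or_exists_resonance_of_abelian`): EITHER `K = 𝔥(H₂)`, and then every corner `ι₂ y π₂`,
   `y ∈ 𝔥(H₂)`, lies in `𝔥(H)`, whence `𝔥(H₁) × 𝔥(H₂) ≅ 𝔥(H)` by the block map and `dim 𝔥(H) = dim 𝔥(H₁) + dim 𝔥(H₂)`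
   (`exists_linearEquiv_prod_hodgeLie_of_corner_mem`); OR `K ⊊ 𝔥(H₂)` is a PROPER rational subspace with the resonance of 3.
   For `H₂ = H¹(E)`, `E` a CM elliptic curve (`𝔥(H₂) = ℚφ₂`, so `K = 0`), the resonance reads `tr(φ₁²) tr(Θ₂φ₂) = c tr(Θ₁φ₁) tr(φ₂²)`,
   `c ∈ ℚ` — gen 48's `incl_comp_proj_mem_hodgeLie_or_exists_traceSlopes_eq`.  §6: the product theorem under the hypothesis that `H₂`
   is TWISTED-RIGID for the slope of `H₁` (`∀ K ≤ 𝔥(H₂), ∀ y₀ ∈ 𝔥(H₂), tr(φ₁²)Θ₂ − tr(Θ₁φ₁)y₀ ∈ K_ℂ → 𝔥(H₂) ≤ K`).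
AV reading (`CorCM/MumfordTateRankCMSurfaceTimesTypeIV`): `dim MT(H¹(A × S)) = dim MT(H¹A) + 2` for `S` a simple CM surface and
`End⁰A` an imaginary quadratic field — Moonen–Zarhin Thm. 0.2 (4) for `S × T`, `T` a simple threefold of type IV: `12`.

## References
* [MoonenZarhin1999LowDim] B. Moonen, Yu. G. Zarhin, *Hodge classes on abelian varieties of low dimension*, Math. Ann. 315 (1999), §3 (3.1),
  Lemma (3.6), Prop. (3.8), (5.6) [corpus: paper:arxiv-math_9901113 pp. 6–7, 10]. [cite: MoonenZarhin1999LowDim, §3 Lemma (3.6)]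
* [Deligne1982HodgeCycles] P. Deligne, *Hodge cycles on abelian varieties*, LNM 900 (1982), I §3 Prop. 3.4 and Prop. 3.6 (`Hg` reductive).
  [cite: Deligne1982HodgeCycles, I §3 Prop. 3.6]
* [Humphreys1972] J. E. Humphreys, GTM 9, §5.1, §19.1 (`L = Z(L) ⊕ [L, L]`). [cite: Humphreys1972, §19.1]
-/

noncomputable section

open scoped TensorProduct

namespace Literature.AlgebraicGeometry.Motives

namespace HodgeStructure

universe u

variable {V₁ : Type u} [AddCommGroup V₁] [Module ℚ V₁] [Module.Finite ℚ V₁]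
  {V₂ : Type u} [AddCommGroup V₂] [Module ℚ V₂] [Module.Finite ℚ V₂]
  {V : Type u} [AddCommGroup V] [Module ℚ V] [Module.Finite ℚ V] [HodgeTensorFacts.{u, u}] {n : ℤ}
  {H₁ : HodgeStructure V₁ n} {H₂ : HodgeStructure V₂ n} {H : HodgeStructure V n}
  (ι₁ : Hom H₁ H) (π₁ : Hom H H₁) (ι₂ : Hom H₂ H) (π₂ : Hom H H₂)
  (hπι₁ : ∀ v, π₁.toLinearMap (ι₁.toLinearMap v) = v) (hπι₂ : ∀ v, π₂.toLinearMap (ι₂.toLinearMap v) = v)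
  (hsum : ∀ v, ι₁.toLinearMap (π₁.toLinearMap v) + ι₂.toLinearMap (π₂.toLinearMap v) = v)
  (ψ : H.Polarization) (ψ₁ : H₁.Polarization)
  {φ₁ : Module.End ℚ V₁} (hφ₁E : φ₁ ∈ H₁.endAlg)
  (hZ₁ : ∀ a ∈ H₁.endAlg, (∀ b ∈ H₁.endAlg, a * b = b * a) →
    (∀ v w, ψ₁.form (a v) w + ψ₁.form v (a w) = 0) → ∃ x : ℚ, a = x • φ₁)
  (hab₂ : ∀ A ∈ H₂.hodgeLie, ∀ B ∈ H₂.hodgeLie, A * B = B * A)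

/-! ## §1 Base-change plumbing -/

omit [Module.Finite ℚ V] [HodgeTensorFacts.{u, u}] in
/-- Base change of a rational multiple: `(c • T)_ℂ = c • T_ℂ`. [folklore] -/
private theorem baseChange_ratCast_smul_ab (c : ℚ) (T : Module.End ℚ V) :
    (c • T).baseChange ℂ = (c : ℂ) • T.baseChange ℂ := by
  refine TensorProduct.AlgebraTensorModule.ext fun z v => ?_
  rw [LinearMap.baseChange_tmul, LinearMap.smul_apply, LinearMap.smul_apply, LinearMap.baseChange_tmul,
    TensorProduct.smul_tmul', ← TensorProduct.smul_tmul, Rat.smul_def, smul_eq_mul]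

omit [Module.Finite ℚ V] [HodgeTensorFacts.{u, u}] in
/-- `(𝔞 ⊔ 𝔟)_ℂ ≤ 𝔞_ℂ ⊔ 𝔟_ℂ` for the complex spans. [folklore] -/
private theorem spanC_sup_le_ab (𝔞 𝔟 : Submodule ℚ (Module.End ℚ V)) : spanC (𝔞 ⊔ 𝔟) ≤ spanC 𝔞 ⊔ spanC 𝔟 := by
  change Submodule.span ℂ _ ≤ _
  rw [Submodule.span_le]
  rintro _ ⟨X, hX, rfl⟩
  obtain ⟨a, ha, b, hb, rfl⟩ := Submodule.mem_sup.1 hX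
  change (a + b).baseChange ℂ ∈ spanC 𝔞 ⊔ spanC 𝔟
  rw [LinearMap.baseChange_add]
  exact Submodule.add_mem _ (Submodule.mem_sup_left (baseChange_mem_spanC ha))
    (Submodule.mem_sup_right (baseChange_mem_spanC hb))

omit [Module.Finite ℚ V] [HodgeTensorFacts.{u, u}] in
/-- `(ℚ z)_ℂ ≤ ℂ z_ℂ`. [folklore] -/
private theorem spanC_span_singleton_le_ab (z : Module.End ℚ V) : spanC (ℚ ∙ z) ≤ ℂ ∙ z.baseChange ℂ := by
  change Submodule.span ℂ _ ≤ _
  rw [Submodule.span_le]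
  rintro _ ⟨X, hX, rfl⟩
  obtain ⟨q, rfl⟩ := Submodule.mem_span_singleton.1 hX
  change (q • z).baseChange ℂ ∈ ℂ ∙ z.baseChange ℂ
  rw [baseChange_ratCast_smul_ab]
  exact Submodule.smul_mem _ _ (Submodule.mem_span_singleton_self _)

/-! ## §2 The abelian summand: brackets have zero `V₂`-block -/

omit [Module.Finite ℚ V₁] in
include hπι₁ hπι₂ hsum hab₂ in
/-- **Brackets of `𝔥(H)` have zero `V₂`-block**: `π₂ D ι₂ = 0` for every `D ∈ [𝔥(H), 𝔥(H)]` (the span of the brackets), since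
`e₂ D = 0` (`comp_eq_zero_of_mem_derived_of_abelian`: `π₂ [X, Y] ι₂ = [π₂ X ι₂, π₂ Y ι₂]` is a bracket in the abelian `𝔥(H₂)`).
(`Hg(X₂)` is a torus: the derived algebra of `𝔥(H)` is supported on `V₁`.) [cite: MoonenZarhin1999LowDim, §3 Lemma (3.6)] -/
theorem restrict₂_eq_zero_of_mem_derived_of_abelian {D : Module.End ℚ V}
    (hD : D ∈ Submodule.span ℚ {B | ∃ X ∈ H.hodgeLie, ∃ Y ∈ H.hodgeLie, X * Y - Y * X = B}) :
    π₂.toLinearMap ∘ₗ D ∘ₗ ι₂.toLinearMap = 0 := by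
  have h := comp_eq_zero_of_mem_derived_of_abelian ι₁ π₁ ι₂ π₂ hπι₁ hπι₂ hsum hab₂ hD
  refine LinearMap.ext fun v => ?_
  have hv := LinearMap.congr_fun h (ι₂.toLinearMap v)
  simp only [LinearMap.comp_apply, LinearMap.zero_apply] at hv ⊢
  have h2 := congrArg π₂.toLinearMap hv
  rw [hπι₂, map_zero] at h2
  exact h2

/-! ## §3 The centre `𝔷(H) = 𝔥(H) ∩ End_Hdg(H)`: first blocks `x φ₁`, and the part `𝔷₀(H)` with zero first block -/

include hπι₁ ψ₁ hZ₁ in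
/-- **A central element `z ∈ 𝔷(H) = 𝔥(H) ∩ End_Hdg(H)` has first block `π₁ z ι₁ = x φ₁`, `x ∈ ℚ`**: the block is a Hodge endomorphism
of `H₁` (composite of morphisms), lies in `𝔥(H₁)` (`comp_mem_hodgeLie_of_retract`), hence is `ψ₁`-skew and commutes with `End_Hdg(H₁)`,
so it is in `ℚφ₁` by (Z₁) («the centre of `Hg(X₁ × X₂)` projects into `Z(Hg X₁)`»). [cite: MoonenZarhin1999LowDim, §3 Lemma (3.6)]
[cite: Deligne1982HodgeCycles, I §3 Prop. 3.6] -/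
theorem exists_restrict₁_eq_smul_of_mem_center {z : Module.End ℚ V} (hz : z ∈ H.hodgeLie ⊓ Subalgebra.toSubmodule H.endAlg) :
    ∃ x : ℚ, π₁.toLinearMap ∘ₗ z ∘ₗ ι₁.toLinearMap = x • φ₁ := by
  obtain ⟨hz𝔥, hzE⟩ := Submodule.mem_inf.1 hz
  rw [Subalgebra.mem_toSubmodule] at hzE
  have hz₁𝔥 : π₁.toLinearMap ∘ₗ z ∘ₗ ι₁.toLinearMap ∈ H₁.hodgeLie := comp_mem_hodgeLie_of_retract ι₁ π₁ hπι₁ hz𝔥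
  have hz₁E : π₁.toLinearMap ∘ₗ z ∘ₗ ι₁.toLinearMap ∈ H₁.endAlg :=
    ((π₁.comp (endAlg.toHom ⟨z, hzE⟩)).comp ι₁).toLinearMap_mem_endAlg
  exact hZ₁ _ hz₁E (fun b hb => commute_of_mem_hodgeLie H₁ hz₁𝔥 ⟨b, hb⟩) (form_apply_add_eq_zero_of_mem_hodgeLie ψ₁ hz₁𝔥)

omit [Module.Finite ℚ V₁] [Module.Finite ℚ V₂] in
include hπι₁ hπι₂ hsum in
/-- **An element of `𝔥(H)` with zero first block is the corner of its second block**: `r₁ z = 0 ⟹ z = ι₂ (π₂ z ι₂) π₂`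
(`eq_sum_blocks_of_mem_hodgeLie`). [cite: Deligne1982HodgeCycles, I §3.1 and Prop. 3.4] -/
theorem eq_corner₂_of_restrict₁_eq_zero {z : Module.End ℚ V} (hz : z ∈ H.hodgeLie)
    (hz₁ : π₁.toLinearMap ∘ₗ z ∘ₗ ι₁.toLinearMap = 0) :
    z = ι₂.toLinearMap ∘ₗ (π₂.toLinearMap ∘ₗ z ∘ₗ ι₂.toLinearMap) ∘ₗ π₂.toLinearMap := by
  have h := eq_sum_blocks_of_mem_hodgeLie ι₁ π₁ ι₂ π₂ hπι₁ hπι₂ hsum hz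
  rw [hz₁, LinearMap.zero_comp, LinearMap.comp_zero, zero_add] at h
  exact h

omit [Module.Finite ℚ V₂] in
include hπι₁ ψ₁ hZ₁ in
/-- **Structure of the centre.**  EITHER every central element has zero first block (`𝔷(H) = 𝔷₀(H)`), OR there is `z₀ ∈ 𝔷(H)` with
`π₁ z₀ ι₁ = x₀ φ₁`, `x₀ ≠ 0`, such that every `z ∈ 𝔷(H)` is `(x/x₀) z₀ + z'` with `z' ∈ 𝔷(H)`, `π₁ z' ι₁ = 0` (for `π₁ z ι₁ = x φ₁`:
`z' = z − (x/x₀) z₀`); i.e. `𝔷(H) ⊆ ℚ z₀ + 𝔷₀(H)`.  («The centre of `Hg(X₁ × X₂)` maps onto a torus of rank `≤ 1` in `Z(Hg X₁)`.»)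
[cite: MoonenZarhin1999LowDim, §3 Lemma (3.6)] [cite: Deligne1982HodgeCycles, I §3 Prop. 3.6] -/
theorem center_le_span_sup_of_abelian :
    (∀ z ∈ H.hodgeLie ⊓ Subalgebra.toSubmodule H.endAlg, π₁.toLinearMap ∘ₗ z ∘ₗ ι₁.toLinearMap = 0) ∨
      ∃ z₀ ∈ H.hodgeLie ⊓ Subalgebra.toSubmodule H.endAlg, ∃ x₀ : ℚ, x₀ ≠ 0 ∧
        π₁.toLinearMap ∘ₗ z₀ ∘ₗ ι₁.toLinearMap = x₀ • φ₁ ∧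
        ∀ z ∈ H.hodgeLie ⊓ Subalgebra.toSubmodule H.endAlg, ∃ x : ℚ,
          z - (x / x₀) • z₀ ∈ H.hodgeLie ⊓ Subalgebra.toSubmodule H.endAlg ∧
            π₁.toLinearMap ∘ₗ (z - (x / x₀) • z₀) ∘ₗ ι₁.toLinearMap = 0 := by
  set 𝔷 := H.hodgeLie ⊓ Subalgebra.toSubmodule H.endAlg with h𝔷
  by_cases hall : ∀ z ∈ 𝔷, π₁.toLinearMap ∘ₗ z ∘ₗ ι₁.toLinearMap = 0
  · exact Or.inl hall
  · right
    push Not at hall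
    obtain ⟨z₀, hz₀, hz₀1⟩ := hall
    obtain ⟨x₀, hx₀⟩ := exists_restrict₁_eq_smul_of_mem_center ι₁ π₁ hπι₁ ψ₁ hZ₁ hz₀
    have hx₀0 : x₀ ≠ 0 := by
      rintro rfl
      rw [zero_smul] at hx₀
      exact hz₀1 hx₀
    refine ⟨z₀, hz₀, x₀, hx₀0, hx₀, fun z hz => ?_⟩
    obtain ⟨x, hx⟩ := exists_restrict₁_eq_smul_of_mem_center ι₁ π₁ hπι₁ ψ₁ hZ₁ hz
    refine ⟨x, Submodule.sub_mem _ hz (Submodule.smul_mem _ _ hz₀), ?_⟩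
    rw [LinearMap.sub_comp, LinearMap.comp_sub, LinearMap.smul_comp, LinearMap.comp_smul, hx, hx₀, smul_smul,
      div_mul_cancel₀ x hx₀0, sub_self]

/-! ## §4 The `Θ`-identity: `tr(φ₁²)·Θ₂ − tr(Θ₁φ₁,ℂ)·(y₀)_ℂ ∈ K_ℂ` with `K = r₂ 𝔷₀(H)` -/

section Theta

variable {Θ₁ : Module.End ℂ (ℂ ⊗[ℚ] V₁)} (hΘ₁ : ∀ p, ∀ x ∈ H₁.piece p (n - p), Θ₁ x = ((2 * p - n : ℤ) : ℂ) • x)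
  {Θ₂ : Module.End ℂ (ℂ ⊗[ℚ] V₂)} (hΘ₂ : ∀ p, ∀ x ∈ H₂.piece p (n - p), Θ₂ x = ((2 * p - n : ℤ) : ℂ) • x)

include hπι₁ hπι₂ hsum ψ hφ₁E hab₂ hΘ₁ hΘ₂ in
/-- **The `Θ`-identity along `ℂ z₀ ⊕ 𝔷₀_ℂ ⊕ 𝔡(H)_ℂ`.**  Let `Z₀` be a rational subspace of `End V` all of whose elements have zero
first block, `z₀` any rational operator with first block `x₀ φ₁`, and suppose `𝔷(H) ⊆ ℚ z₀ + Z₀`.  Then for some `λ ∈ ℂ`: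
`tr(Θ₁ φ₁,ℂ) = λ x₀ tr(φ₁²)` AND `Θ₂ − λ (π₂ z₀ ι₂)_ℂ ∈ (π₂ Z₀ ι₂)_ℂ`.  Indeed `Θ_H ∈ 𝔥(H)_ℂ = (𝔷(H) ⊕ 𝔡(H))_ℂ ⊆ ℂ z₀,ℂ + Z₀,ℂ + 𝔡(H)_ℂ`
(Deligne: `𝔥 = 𝔷 ⊕ 𝔡`, `AnyWeight.hodgeLie_center_sup_derived_eq`), say `Θ_H = λ z₀,ℂ + k + s`; the `ℂ`-linear trace functional
`Z ↦ tr((π₁,ℂ Z ι₁,ℂ) φ₁,ℂ)` sends `Θ_H ↦ tr(Θ₁ φ₁,ℂ)`, kills `Z₀,ℂ` (zero first blocks) and `𝔡(H)_ℂ` (§2 of `HodgeLieTimesCMCurve`) and sends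
`z₀,ℂ ↦ x₀ tr(φ₁²)`; the `ℂ`-linear block map `Z ↦ π₂,ℂ Z ι₂,ℂ` sends `Θ_H ↦ Θ₂`, `z₀,ℂ ↦ (π₂ z₀ ι₂)_ℂ`, `Z₀,ℂ` into `(π₂ Z₀ ι₂)_ℂ`, and kills
`𝔡(H)_ℂ` (§2). [cite: Deligne1982HodgeCycles, I §3 Prop. 3.6] [cite: MoonenZarhin1999LowDim, §3 Lemma (3.6)] -/
theorem exists_trace_eq_and_theta_sub_smul_mem_spanC {z₀ : Module.End ℚ V} {x₀ : ℚ}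
    (hx₀ : π₁.toLinearMap ∘ₗ z₀ ∘ₗ ι₁.toLinearMap = x₀ • φ₁) (Z₀ : Submodule ℚ (Module.End ℚ V))
    (hZ₀1 : ∀ z ∈ Z₀, π₁.toLinearMap ∘ₗ z ∘ₗ ι₁.toLinearMap = 0)
    (hle : H.hodgeLie ⊓ Subalgebra.toSubmodule H.endAlg ≤ (ℚ ∙ z₀) ⊔ Z₀) :
    ∃ lam : ℂ, LinearMap.trace ℂ _ (Θ₁ * φ₁.baseChange ℂ) = lam * x₀ * ((LinearMap.trace ℚ V₁ (φ₁ * φ₁) : ℚ) : ℂ) ∧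
      Θ₂ - lam • (π₂.toLinearMap ∘ₗ z₀ ∘ₗ ι₂.toLinearMap).baseChange ℂ ∈
        spanC (Z₀.map ((LinearMap.llcomp ℚ V₂ V V₂ π₂.toLinearMap).comp (LinearMap.lcomp ℚ V ι₂.toLinearMap))) := by
  classical
  -- `Θ_H` and the presentation
  obtain ⟨ΘU, hΘU⟩ := exists_hodgeTheta H
  have hπι₁' : π₁.toLinearMap ∘ₗ ι₁.toLinearMap = LinearMap.id := LinearMap.ext hπι₁
  have hπι₂' : π₂.toLinearMap ∘ₗ ι₂.toLinearMap = LinearMap.id := LinearMap.ext hπι₂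
  have hι₁F : ∀ p, ∀ x ∈ H₁.piece p (n - p), ι₁.toLinearMap.baseChange ℂ x ∈ H.piece p (n - p) :=
    fun p x hx => ι₁.map_piece_le p _ ⟨x, hx, rfl⟩
  have hι₂F : ∀ p, ∀ x ∈ H₂.piece p (n - p), ι₂.toLinearMap.baseChange ℂ x ∈ H.piece p (n - p) :=
    fun p x hx => ι₂.map_piece_le p _ ⟨x, hx, rfl⟩
  have hΘι₁ := theta_incl_eq H H₁ hι₁F hΘU hΘ₁
  have hΘι₂ := theta_incl_eq H H₂ hι₂F hΘU hΘ₂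
  have hrΘ₁ : π₁.toLinearMap.baseChange ℂ ∘ₗ ΘU ∘ₗ ι₁.toLinearMap.baseChange ℂ = Θ₁ := by
    refine LinearMap.ext fun x => ?_
    rw [LinearMap.comp_apply, LinearMap.comp_apply, hΘι₁, proj_incl_baseChange hπι₁']
  have hrΘ₂ : π₂.toLinearMap.baseChange ℂ ∘ₗ ΘU ∘ₗ ι₂.toLinearMap.baseChange ℂ = Θ₂ := by
    refine LinearMap.ext fun x => ?_
    rw [LinearMap.comp_apply, LinearMap.comp_apply, hΘι₂, proj_incl_baseChange hπι₂']
  -- the rational and complex block maps and the trace functional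
  set r₂Q : Module.End ℚ V →ₗ[ℚ] Module.End ℚ V₂ :=
    (LinearMap.llcomp ℚ V₂ V V₂ π₂.toLinearMap).comp (LinearMap.lcomp ℚ V ι₂.toLinearMap) with hr₂Qdef
  have hr₂Q : ∀ X, r₂Q X = π₂.toLinearMap ∘ₗ X ∘ₗ ι₂.toLinearMap := fun X => rfl
  let r₁ : Module.End ℂ (ℂ ⊗[ℚ] V) →ₗ[ℂ] Module.End ℂ (ℂ ⊗[ℚ] V₁) :=
    (LinearMap.llcomp ℂ _ _ _ (π₁.toLinearMap.baseChange ℂ)).comp (LinearMap.lcomp ℂ _ (ι₁.toLinearMap.baseChange ℂ))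
  let r₂ : Module.End ℂ (ℂ ⊗[ℚ] V) →ₗ[ℂ] Module.End ℂ (ℂ ⊗[ℚ] V₂) :=
    (LinearMap.llcomp ℂ _ _ _ (π₂.toLinearMap.baseChange ℂ)).comp (LinearMap.lcomp ℂ _ (ι₂.toLinearMap.baseChange ℂ))
  have hr₁ : ∀ Z, r₁ Z = π₁.toLinearMap.baseChange ℂ ∘ₗ Z ∘ₗ ι₁.toLinearMap.baseChange ℂ := fun Z => rfl
  have hr₂ : ∀ Z, r₂ Z = π₂.toLinearMap.baseChange ℂ ∘ₗ Z ∘ₗ ι₂.toLinearMap.baseChange ℂ := fun Z => rfl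
  have hr₂bc : ∀ X : Module.End ℚ V, r₂ (X.baseChange ℂ) = (π₂.toLinearMap ∘ₗ X ∘ₗ ι₂.toLinearMap).baseChange ℂ := fun X => by
    rw [hr₂, ← LinearMap.baseChange_comp, ← LinearMap.baseChange_comp]
  let ℓ₁ : Module.End ℂ (ℂ ⊗[ℚ] V) →ₗ[ℂ] ℂ := (LinearMap.trace ℂ _).comp ((LinearMap.mulRight ℂ (φ₁.baseChange ℂ)).comp r₁)
  have hℓ₁ : ∀ Z, ℓ₁ Z = LinearMap.trace ℂ _ ((π₁.toLinearMap.baseChange ℂ ∘ₗ Z ∘ₗ ι₁.toLinearMap.baseChange ℂ) * φ₁.baseChange ℂ) :=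
    fun Z => rfl
  have hℓ₁Q : ∀ X : Module.End ℚ V, ℓ₁ (X.baseChange ℂ) =
      ((LinearMap.trace ℚ V₁ ((π₁.toLinearMap ∘ₗ X ∘ₗ ι₁.toLinearMap) * φ₁) : ℚ) : ℂ) := fun X => by
    rw [hℓ₁, ← LinearMap.baseChange_comp, ← LinearMap.baseChange_comp, ← LinearMap.baseChange_mul, LinearMap.trace_baseChange,
      eq_ratCast]
  -- the derived part `𝔡`: both `ℓ₁` and `r₂` kill `𝔡_ℂ`
  set 𝔡 : Submodule ℚ (Module.End ℚ V) := Submodule.span ℚ {B | ∃ X ∈ H.hodgeLie, ∃ Y ∈ H.hodgeLie, X * Y - Y * X = B} with h𝔡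
  have h𝔡ℓ₁ : ∀ B ∈ 𝔡, LinearMap.trace ℚ V₁ ((π₁.toLinearMap ∘ₗ B ∘ₗ ι₁.toLinearMap) * φ₁) = 0 := by
    intro B hB
    induction hB using Submodule.span_induction with
    | mem B hB =>
      obtain ⟨X, hX, Y, hY, rfl⟩ := hB
      exact trace_restrict₁_commutator_mul_eq_zero ι₁ π₁ hπι₁ hφ₁E hX hY
    | zero => rw [LinearMap.zero_comp, LinearMap.comp_zero, zero_mul, map_zero]
    | add B B' _ _ hB hB' => rw [LinearMap.add_comp, LinearMap.comp_add, add_mul, map_add, hB, hB', add_zero]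
    | smul c B _ hB => rw [LinearMap.smul_comp, LinearMap.comp_smul, smul_mul_assoc, map_smul, hB, smul_zero]
  have hCℓ₁ : ∀ s ∈ spanC 𝔡, ℓ₁ s = 0 := by
    intro s hs
    change s ∈ Submodule.span ℂ _ at hs
    induction hs using Submodule.span_induction with
    | mem s hs =>
      obtain ⟨B, hB, rfl⟩ := hs
      rw [hℓ₁Q, h𝔡ℓ₁ B hB, Rat.cast_zero]
    | zero => exact map_zero ℓ₁
    | add s s' _ _ hs hs' => rw [map_add, hs, hs', add_zero]
    | smul c s _ hs => rw [map_smul, hs, smul_zero]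
  have hCr₂ : ∀ s ∈ spanC 𝔡, r₂ s = 0 := by
    intro s hs
    change s ∈ Submodule.span ℂ _ at hs
    induction hs using Submodule.span_induction with
    | mem s hs =>
      obtain ⟨B, hB, rfl⟩ := hs
      rw [hr₂bc, restrict₂_eq_zero_of_mem_derived_of_abelian ι₁ π₁ ι₂ π₂ hπι₁ hπι₂ hsum hab₂ hB, LinearMap.baseChange_zero]
    | zero => exact map_zero r₂
    | add s s' _ _ hs hs' => rw [map_add, hs, hs', add_zero]
    | smul c s _ hs => rw [map_smul, hs, smul_zero]
  -- `Z₀`: `ℓ₁` kills `Z₀,ℂ`, `r₂` maps it into `(r₂ Z₀)_ℂ`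
  have hCℓ₁Z : ∀ k ∈ spanC Z₀, ℓ₁ k = 0 := by
    intro k hk
    change k ∈ Submodule.span ℂ _ at hk
    induction hk using Submodule.span_induction with
    | mem k hk =>
      obtain ⟨z, hz, rfl⟩ := hk
      rw [hℓ₁Q, hZ₀1 z hz, zero_mul, map_zero, Rat.cast_zero]
    | zero => exact map_zero ℓ₁
    | add k k' _ _ hk hk' => rw [map_add, hk, hk', add_zero]
    | smul c k _ hk => rw [map_smul, hk, smul_zero]
  have hCr₂Z : ∀ k ∈ spanC Z₀, r₂ k ∈ spanC (Z₀.map r₂Q) := by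
    intro k hk
    change k ∈ Submodule.span ℂ _ at hk
    induction hk using Submodule.span_induction with
    | mem k hk =>
      obtain ⟨z, hz, rfl⟩ := hk
      rw [hr₂bc]
      exact baseChange_mem_spanC (Submodule.mem_map_of_mem (f := r₂Q) hz)
    | zero => rw [map_zero]; exact Submodule.zero_mem _
    | add k k' _ _ hk hk' => rw [map_add]; exact Submodule.add_mem _ hk hk'
    | smul c k _ hk => rw [map_smul]; exact Submodule.smul_mem _ _ hk
  -- `Θ_H = λ z₀,ℂ + k + s`
  have hΘ𝔥 : ΘU ∈ spanC H.hodgeLie := (hodgeLieC_eq_spanC H) ▸ H.mem_hodgeLieC_of_forall_piece hΘU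
  have h𝔥le : H.hodgeLie ≤ ((ℚ ∙ z₀) ⊔ Z₀) ⊔ 𝔡 := by
    rw [← AnyWeight.hodgeLie_center_sup_derived_eq H ψ]
    exact sup_le_sup_right hle _
  have hΘmem : ΘU ∈ ((ℂ ∙ z₀.baseChange ℂ) ⊔ spanC Z₀) ⊔ spanC 𝔡 :=
    (sup_le_sup_right ((spanC_sup_le_ab _ _).trans (sup_le_sup_right (spanC_span_singleton_le_ab z₀) _)) _)
      (spanC_sup_le_ab _ _ (spanC_mono h𝔥le hΘ𝔥))
  obtain ⟨ak, hak, s, hs, haks⟩ := Submodule.mem_sup.1 hΘmem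
  obtain ⟨a, ha, k, hk, rfl⟩ := Submodule.mem_sup.1 hak
  obtain ⟨lam, rfl⟩ := Submodule.mem_span_singleton.1 ha
  refine ⟨lam, ?_, ?_⟩
  · -- the trace identity
    have h := congrArg ℓ₁ haks
    rw [map_add, map_add, map_smul, hCℓ₁ s hs, hCℓ₁Z k hk, add_zero, add_zero, hℓ₁Q, hx₀, smul_mul_assoc, map_smul,
      smul_eq_mul, smul_eq_mul, Rat.cast_mul, hℓ₁, hrΘ₁] at h
    rw [← h]
    ring
  · -- the block identity
    have h := congrArg r₂ haks
    rw [map_add, map_add, map_smul, hCr₂ s hs, add_zero, hr₂bc, hr₂ ΘU, hrΘ₂] at h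
    have hk' : r₂ k = Θ₂ - lam • (π₂.toLinearMap ∘ₗ z₀ ∘ₗ ι₂.toLinearMap).baseChange ℂ := by
      rw [← h, add_sub_cancel_left]
    rw [← hk']
    exact hCr₂Z k hk

end Theta

/-! ## §5 The dichotomy: all corners of `𝔥(H₂)` lie in `𝔥(H)`, or resonance along a proper rational subspace `K ⊊ 𝔥(H₂)` -/

section Dichotomy

variable {Θ₁ : Module.End ℂ (ℂ ⊗[ℚ] V₁)} (hΘ₁ : ∀ p, ∀ x ∈ H₁.piece p (n - p), Θ₁ x = ((2 * p - n : ℤ) : ℂ) • x)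
  {Θ₂ : Module.End ℂ (ℂ ⊗[ℚ] V₂)} (hΘ₂ : ∀ p, ∀ x ∈ H₂.piece p (n - p), Θ₂ x = ((2 * p - n : ℤ) : ℂ) • x)

include hπι₁ hπι₂ hsum ψ ψ₁ hφ₁E hZ₁ hab₂ hΘ₁ hΘ₂ in
/-- **Moonen–Zarhin Lemma (3.6) for `𝔥(H)`, abelian summand of any rank, as a dichotomy.**  For `H ≅ H₁ ⊕ H₂` with `𝔥(H₂)` ABELIAN and
`H₁` with `ψ₁`-skew centre of `End_Hdg(H₁)` inside `ℚφ₁`: EITHER every corner `ι₂ y π₂`, `y ∈ 𝔥(H₂)`, lies in `𝔥(H)` («`Hg(X₂) ⊆ Hg(X₁ × X₂)`»;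
then `𝔥(H) = 𝔥(H₁) × 𝔥(H₂)`, §6), OR there are a PROPER rational subspace `K ⊊ 𝔥(H₂)` (`K ≤ 𝔥(H₂)`, some `y ∈ 𝔥(H₂)` outside `K`) and
`y₀ ∈ 𝔥(H₂)` with the RESONANCE `tr(φ₁²)·Θ₂ − tr(Θ₁ φ₁,ℂ)·(y₀)_ℂ ∈ K_ℂ` — the infinitesimal form of «the centre of `Hg(X₁)` (a torus of
rank `≤ 1` over `ℚφ₁`) contains a torus `ℚ`-isogenous to a quotient of `Hg(X₂)` by the subtorus with Lie algebra `K`».  Here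
`K = r₂ 𝔷₀(H)` is the space of second blocks of the central elements of `𝔥(H)` with zero first block.
[cite: MoonenZarhin1999LowDim, §3 Lemma (3.6) and Prop. (3.8)] [cite: Deligne1982HodgeCycles, I §3 Prop. 3.6] -/
theorem forall_corner_mem_or_exists_resonance_of_abelian :
    (∀ y ∈ H₂.hodgeLie, ι₂.toLinearMap ∘ₗ y ∘ₗ π₂.toLinearMap ∈ H.hodgeLie) ∨
      ∃ K : Submodule ℚ (Module.End ℚ V₂), K ≤ H₂.hodgeLie ∧ (∃ y ∈ H₂.hodgeLie, y ∉ K) ∧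
        ∃ y₀ ∈ H₂.hodgeLie, ((LinearMap.trace ℚ V₁ (φ₁ * φ₁) : ℚ) : ℂ) • Θ₂ -
          LinearMap.trace ℂ _ (Θ₁ * φ₁.baseChange ℂ) • y₀.baseChange ℂ ∈ spanC K := by
  classical
  set 𝔷 := H.hodgeLie ⊓ Subalgebra.toSubmodule H.endAlg with h𝔷
  set r₁Q : Module.End ℚ V →ₗ[ℚ] Module.End ℚ V₁ :=
    (LinearMap.llcomp ℚ V₁ V V₁ π₁.toLinearMap).comp (LinearMap.lcomp ℚ V ι₁.toLinearMap) with hr₁Qdef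
  have hr₁Q : ∀ X, r₁Q X = π₁.toLinearMap ∘ₗ X ∘ₗ ι₁.toLinearMap := fun X => rfl
  set r₂Q : Module.End ℚ V →ₗ[ℚ] Module.End ℚ V₂ :=
    (LinearMap.llcomp ℚ V₂ V V₂ π₂.toLinearMap).comp (LinearMap.lcomp ℚ V ι₂.toLinearMap) with hr₂Qdef
  have hr₂Q : ∀ X, r₂Q X = π₂.toLinearMap ∘ₗ X ∘ₗ ι₂.toLinearMap := fun X => rfl
  -- `𝔷₀ = {z ∈ 𝔷 : r₁ z = 0}` and `K = r₂ 𝔷₀`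
  set Z₀ : Submodule ℚ (Module.End ℚ V) := 𝔷 ⊓ LinearMap.ker r₁Q with hZ₀def
  have hZ₀𝔥 : Z₀ ≤ H.hodgeLie := fun z hz => (Submodule.mem_inf.1 (Submodule.mem_inf.1 hz).1).1
  have hZ₀1 : ∀ z ∈ Z₀, π₁.toLinearMap ∘ₗ z ∘ₗ ι₁.toLinearMap = 0 := fun z hz => by
    rw [← hr₁Q]; exact LinearMap.mem_ker.1 (Submodule.mem_inf.1 hz).2
  set K : Submodule ℚ (Module.End ℚ V₂) := Z₀.map r₂Q with hKdef
  have hK𝔥 : K ≤ H₂.hodgeLie := by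
    rintro _ ⟨z, hz, rfl⟩
    rw [hr₂Q]
    exact comp_mem_hodgeLie_of_retract ι₂ π₂ hπι₂ (hZ₀𝔥 hz)
  by_cases hgood : H₂.hodgeLie ≤ K
  · -- every corner lies in `𝔥(H)`: `y = r₂ z` with `z ∈ 𝔷₀`, and `z = ι₂ y π₂`
    left
    intro y hy
    obtain ⟨z, hz, hzy⟩ := Submodule.mem_map.1 (hgood hy)
    rw [hr₂Q] at hzy
    have hzeq := eq_corner₂_of_restrict₁_eq_zero ι₁ π₁ ι₂ π₂ hπι₁ hπι₂ hsum (hZ₀𝔥 hz) (hZ₀1 z hz)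
    rw [hzy] at hzeq
    rw [← hzeq]
    exact hZ₀𝔥 hz
  · right
    refine ⟨K, hK𝔥, ?_, ?_⟩
    · by_contra hno
      push Not at hno
      exact hgood fun y hy => hno y hy
    -- the structure of the centre, then the `Θ`-identity
    rcases center_le_span_sup_of_abelian ι₁ π₁ hπι₁ ψ₁ hZ₁ with hall | ⟨z₀, hz₀, x₀, hx₀0, hx₀, hrest⟩
    · -- `𝔷 = 𝔷₀`: `Θ₂ ∈ K_ℂ` and `tr(Θ₁ φ₁) = 0`; take `y₀ = 0`
      have hle : 𝔷 ≤ (ℚ ∙ (0 : Module.End ℚ V)) ⊔ Z₀ := fun z hz =>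
        Submodule.mem_sup_right (Submodule.mem_inf.2 ⟨hz, LinearMap.mem_ker.2 (by rw [hr₁Q]; exact hall z hz)⟩)
      have hx : π₁.toLinearMap ∘ₗ (0 : Module.End ℚ V) ∘ₗ ι₁.toLinearMap = (0 : ℚ) • φ₁ := by
        rw [LinearMap.zero_comp, LinearMap.comp_zero, zero_smul]
      obtain ⟨lam, htr, hΘ⟩ := exists_trace_eq_and_theta_sub_smul_mem_spanC ι₁ π₁ ι₂ π₂ hπι₁ hπι₂ hsum ψ hφ₁E hab₂ hΘ₁ hΘ₂
        hx Z₀ hZ₀1 hle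
      refine ⟨0, Submodule.zero_mem _, ?_⟩
      rw [Rat.cast_zero, mul_zero, zero_mul] at htr
      rw [LinearMap.zero_comp, LinearMap.comp_zero, LinearMap.baseChange_zero, smul_zero, sub_zero] at hΘ
      rw [htr, LinearMap.baseChange_zero, smul_zero, sub_zero]
      exact Submodule.smul_mem _ _ hΘ
    · -- `𝔷 = ℚ z₀ ⊕ 𝔷₀` with `r₁ z₀ = x₀ φ₁`, `x₀ ≠ 0`; take `y₀ = x₀⁻¹ r₂ z₀`
      have hle : 𝔷 ≤ (ℚ ∙ z₀) ⊔ Z₀ := by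
        intro z hz
        obtain ⟨x, hz', hz'1⟩ := hrest z hz
        have hzeq : z = (x / x₀) • z₀ + (z - (x / x₀) • z₀) := by rw [add_sub_cancel]
        rw [hzeq]
        exact Submodule.add_mem _ (Submodule.mem_sup_left (Submodule.smul_mem _ _ (Submodule.mem_span_singleton_self _)))
          (Submodule.mem_sup_right (Submodule.mem_inf.2 ⟨hz', LinearMap.mem_ker.2 (by rw [hr₁Q]; exact hz'1)⟩))
      obtain ⟨lam, htr, hΘ⟩ := exists_trace_eq_and_theta_sub_smul_mem_spanC ι₁ π₁ ι₂ π₂ hπι₁ hπι₂ hsum ψ hφ₁E hab₂ hΘ₁ hΘ₂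
        hx₀ Z₀ hZ₀1 hle
      have hz₀𝔥 : z₀ ∈ H.hodgeLie := (Submodule.mem_inf.1 hz₀).1
      refine ⟨x₀⁻¹ • (π₂.toLinearMap ∘ₗ z₀ ∘ₗ ι₂.toLinearMap),
        Submodule.smul_mem _ _ (comp_mem_hodgeLie_of_retract ι₂ π₂ hπι₂ hz₀𝔥), ?_⟩
      -- `tr(φ₁²) Θ₂ − tr(Θ₁φ₁) x₀⁻¹ (r₂ z₀)_ℂ = tr(φ₁²) (Θ₂ − λ (r₂ z₀)_ℂ)`
      have hx₀C : (x₀ : ℂ) ≠ 0 := by exact_mod_cast hx₀0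
      have heq : ((LinearMap.trace ℚ V₁ (φ₁ * φ₁) : ℚ) : ℂ) • Θ₂ -
          LinearMap.trace ℂ _ (Θ₁ * φ₁.baseChange ℂ) • (x₀⁻¹ • (π₂.toLinearMap ∘ₗ z₀ ∘ₗ ι₂.toLinearMap)).baseChange ℂ =
          ((LinearMap.trace ℚ V₁ (φ₁ * φ₁) : ℚ) : ℂ) • (Θ₂ - lam • (π₂.toLinearMap ∘ₗ z₀ ∘ₗ ι₂.toLinearMap).baseChange ℂ) := by
        rw [baseChange_ratCast_smul_ab, htr, smul_sub, smul_smul, smul_smul, Rat.cast_inv]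
        congr 2
        field_simp
      rw [heq]
      exact Submodule.smul_mem _ _ hΘ

end Dichotomy

/-! ## §6 Twisted rigidity of `H₂` ⟹ corner membership ⟹ `𝔥(H) = 𝔥(H₁) × 𝔥(H₂)` -/

section Product

variable {Θ₁ : Module.End ℂ (ℂ ⊗[ℚ] V₁)} (hΘ₁ : ∀ p, ∀ x ∈ H₁.piece p (n - p), Θ₁ x = ((2 * p - n : ℤ) : ℂ) • x)
  {Θ₂ : Module.End ℂ (ℂ ⊗[ℚ] V₂)} (hΘ₂ : ∀ p, ∀ x ∈ H₂.piece p (n - p), Θ₂ x = ((2 * p - n : ℤ) : ℂ) • x)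
  (hrig : ∀ K : Submodule ℚ (Module.End ℚ V₂), K ≤ H₂.hodgeLie → ∀ y₀ ∈ H₂.hodgeLie,
    ((LinearMap.trace ℚ V₁ (φ₁ * φ₁) : ℚ) : ℂ) • Θ₂ - LinearMap.trace ℂ _ (Θ₁ * φ₁.baseChange ℂ) • y₀.baseChange ℂ ∈ spanC K →
      H₂.hodgeLie ≤ K)

include hπι₁ hπι₂ hsum ψ ψ₁ hφ₁E hZ₁ hab₂ hΘ₁ hΘ₂ hrig in
/-- **`𝔥(H) = 𝔥(H₁) × 𝔥(H₂)` for an abelian summand `H₂` which is twisted-rigid for the slope of `H₁`** (no proper rational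
`K ⊊ 𝔥(H₂)` carries the resonance; for `H₂ = H¹S`, `S` a simple CM surface, and `φ₁² = −d`, this is
`Motives/HodgeLieRankFourTwistedRigidity`), in three readings: (1) every corner `ι₂ y π₂`, `y ∈ 𝔥(H₂)`, lies in `𝔥(H)`
(«`Hg(X₂) ⊆ Hg(X₁ × X₂)`», §5); (2) `𝔥(H)` contains the first corner `ι₁ (π₁ X ι₁) π₁ = X − ι₂ (π₂ X ι₂) π₂` of each of its elements;
(3) `𝔥(H₁) × 𝔥(H₂) ≅ 𝔥(H)` by the block map (`exists_linearEquiv_prod_hodgeLie_of_corner_mem`) and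
`dim_ℚ 𝔥(H) = dim_ℚ 𝔥(H₁) + dim_ℚ 𝔥(H₂)` — Moonen–Zarhin's «`Hg(X₁ × X₂) = Hg(X₁) × Hg(X₂)` unless the centre of `Hg(X₁)` contains a
torus isogenous to `Hg(X₂)`», for the Lie algebra `hodgeLie`, with NO hypothesis on `H₁` beyond the rank-one skew centre.
[cite: MoonenZarhin1999LowDim, §3 Lemma (3.6) and (3.1)] [cite: Deligne1982HodgeCycles, I §3 Prop. 3.4 and Prop. 3.6] -/
theorem corners_mem_and_exists_linearEquiv_prod_of_abelian_of_rigid :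
    (∀ y ∈ H₂.hodgeLie, ι₂.toLinearMap ∘ₗ y ∘ₗ π₂.toLinearMap ∈ H.hodgeLie) ∧
      (∀ X ∈ H.hodgeLie, ι₁.toLinearMap ∘ₗ (π₁.toLinearMap ∘ₗ X ∘ₗ ι₁.toLinearMap) ∘ₗ π₁.toLinearMap ∈ H.hodgeLie) ∧
      (∃ Φ : (H₁.hodgeLie × H₂.hodgeLie) ≃ₗ[ℚ] H.hodgeLie, ∀ Y : H₁.hodgeLie × H₂.hodgeLie,
        ((Φ Y : H.hodgeLie) : Module.End ℚ V) =
          ι₁.toLinearMap ∘ₗ (Y.1 : Module.End ℚ V₁) ∘ₗ π₁.toLinearMap + ι₂.toLinearMap ∘ₗ (Y.2 : Module.End ℚ V₂) ∘ₗ π₂.toLinearMap) ∧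
      Module.finrank ℚ H.hodgeLie = Module.finrank ℚ H₁.hodgeLie + Module.finrank ℚ H₂.hodgeLie := by
  -- (1) second corners
  have h₂ : ∀ y ∈ H₂.hodgeLie, ι₂.toLinearMap ∘ₗ y ∘ₗ π₂.toLinearMap ∈ H.hodgeLie := by
    intro y hy
    rcases forall_corner_mem_or_exists_resonance_of_abelian ι₁ π₁ ι₂ π₂ hπι₁ hπι₂ hsum ψ ψ₁ hφ₁E hZ₁ hab₂ hΘ₁ hΘ₂ with
      hgood | ⟨K, hK, ⟨y', hy', hy'K⟩, y₀, hy₀, hres⟩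
    · exact hgood y hy
    · exact absurd (hrig K hK y₀ hy₀ hres hy') hy'K
  -- (2) first corners
  have h₁ : ∀ X ∈ H.hodgeLie, ι₁.toLinearMap ∘ₗ (π₁.toLinearMap ∘ₗ X ∘ₗ ι₁.toLinearMap) ∘ₗ π₁.toLinearMap ∈ H.hodgeLie := by
    intro X hX
    have hc := h₂ _ (comp_mem_hodgeLie_of_retract ι₂ π₂ hπι₂ hX)
    have hsplit := eq_sum_blocks_of_mem_hodgeLie ι₁ π₁ ι₂ π₂ hπι₁ hπι₂ hsum hX
    have heq : ι₁.toLinearMap ∘ₗ (π₁.toLinearMap ∘ₗ X ∘ₗ ι₁.toLinearMap) ∘ₗ π₁.toLinearMap =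
        X - ι₂.toLinearMap ∘ₗ (π₂.toLinearMap ∘ₗ X ∘ₗ ι₂.toLinearMap) ∘ₗ π₂.toLinearMap := by
      rw [eq_sub_iff_add_eq]
      exact hsplit.symm
    rw [heq]
    exact Submodule.sub_mem _ hX hc
  -- (3) the block isomorphism
  obtain ⟨Φ, hΦ⟩ := exists_linearEquiv_prod_hodgeLie_of_corner_mem ι₁ π₁ ι₂ π₂ hπι₁ hπι₂ hsum h₁
  refine ⟨h₂, h₁, ⟨Φ, hΦ⟩, ?_⟩
  rw [← Φ.finrank_eq, Module.finrank_prod]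

end Product

end HodgeStructure

end Literature.AlgebraicGeometry.Motives

end
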